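import Summits.AtomisticToContinuum.Crystallization.Theorems.PalmUnimodularRigidityUnimodularEnergyLowerBound
import Summits.AtomisticToContinuum.Crystallization.Theorems.PalmUnimodularRigidityMinimiserShellsEnergyFloorC
import Literature.Probability.Process.PointStationaryTransfer
import HarnessLib

/-!
# First variation of Palm copositivity — auxiliary lemmas
# (for stub `stub_rootEnergyLeOfCopositivity` of line `perron_transfer`, crux `IsometryAtoms.MinimisingLawsHaveAtoms`,
# stmt-AtomisticToContinuum-15776)

This file: measurable kernel versions of the weighted functionals, the splitting `w + sF = 1`, the Mecke
symmetrisation in `ℝ≥0∞` and real form, the variation inequality at `w = 1 - s f` in real numbers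
(`relc_variation`), and the abstract first-order condition (`relc_first_order`).  The stub itself is assembled in
`IsometryAtomsMinimisingLawsHaveAtomsRootEnergyLeOfCopositivity.lean`.

**Theorem** (`stub_rootEnergyLeOfCopositivity`, next file).  Let `P` be a point-stationary probability law on configurations of
`ℝ³`, almost surely a rooted `δ`-hard-core counting measure, MINIMISING (`E_P[h] ≤ e*`, `h = rootEnergy V_LJ`,
`e* = ⨅_Q e(Q)`), and suppose PALM COPOSITIVITY: for every measurable weight `w ≤ 1` on configurations,
`E_P[w(μ) Σ_z w(θ_z μ) V⁻(‖z‖)] ≤ E_P[w(μ) Σ_z w(θ_z μ) V⁺(‖z‖)] + 2(-e*) E_P[w²]` (`θ_z μ = μ.map (· - z)`).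
Then `h(μ) ≤ e*` for `P`-almost every `μ`.

**Proof** (first variation at `w ≡ 1`).  Let `h'` be the measurable root energy (`EnergyFloor.rootEnergy'`, equal to
`h` on hard-core configurations), `B = {e* < h'}`, `f = 1_B`, and `w_s = 1 - s f` (`0 < s ≤ 1/2`).  All functionals are
finite on hard-core configurations, so copositivity at `w_s` reads, in real numbers and after expanding,
`0 ≤ (E[u] - 2e*) + s·(first order) + s²·(bounded)`, `u = 2h`.  The Mecke identity symmetrises the first-order term to
`-4 E[f (h' - e*)]`, minimality kills the zeroth-order term, whence `E[f (h' - e*)] ≤ s C / 4` for every small `s > 0`,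
i.e. `E[1_B (h' - e*)] ≤ 0`; the integrand is non-negative, so `P(B) = 0`.  All `[folklore]` bookkeeping.
-/

noncomputable section

namespace Summit.AtomisticToContinuum.Crystallization.Theorems.IsometryAtomsMinimisingLawsHaveAtoms

open MeasureTheory ProbabilityTheory Set Filter
open scoped ENNReal
open Literature.MathematicalPhysics.StatisticalMechanics (lennardJones rootEnergy PeriodicConfiguration)
open Literature.Probability.Process (IsRootedHardCore IsPointStationaryLaw measurable_map_sub_kernel)
open Summit.AtomisticToContinuum.Crystallization.Theorems.ChargedEnergyGapNegative (E3 eStar)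
open Summit.AtomisticToContinuum.Crystallization.Theorems.UnimodularEnergy (exists_kernel_eq_self
  measurable_ofReal_lennardJones_norm measurable_ofReal_neg_lennardJones_norm eStar_nonpos)
open Summit.AtomisticToContinuum.Crystallization.Theorems.PalmUnimodularRigidityMinimiserShells.EnergyFloor
  (rootEnergy' measurable_rootEnergy' rootEnergy'_eq_of_hc rootEnergy'_bounds_of_hc lintegral_pos_le_of_hc
    lintegral_neg_le_of_hc)

/-! ## Measurable weighted functionals, splitting, Mecke symmetrisation -/

section Aux

variable {δ : ℝ} {P : Measure (Measure E3)}

/-- For an s-finite kernel `κ` on configurations, a measurable weight `F` and a measurable field `q ≥ 0`, the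
weighted functional `μ ↦ ∫ F(θ_z (κ μ)) q(z) d(κ μ)(z)` is measurable. [folklore] -/
theorem relc_measurable_weighted (κ : Kernel (Measure E3) E3) [IsSFiniteKernel κ]
    {F : Measure E3 → ℝ≥0∞} (hF : Measurable F) {q : E3 → ℝ≥0∞} (hq : Measurable q) :
    Measurable fun μ : Measure E3 => ∫⁻ z, F ((κ μ).map (fun x => x - z)) * q z ∂(κ μ) := by
  have h : Measurable (Function.uncurry fun (μ : Measure E3) (z : E3) =>
      F ((κ μ).map (fun x => x - z)) * q z) :=
    (hF.comp (measurable_map_sub_kernel κ)).mul (hq.comp measurable_snd)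
  exact h.lintegral_kernel_prod_right

/-- For fixed `μ`, the integrand `z ↦ F(θ_z (κ μ)) q(z)` is measurable. [folklore] -/
theorem relc_measurable_section (κ : Kernel (Measure E3) E3) [IsSFiniteKernel κ]
    {F : Measure E3 → ℝ≥0∞} (hF : Measurable F) {q : E3 → ℝ≥0∞} (hq : Measurable q) (μ : Measure E3) :
    Measurable fun z : E3 => F ((κ μ).map (fun x => x - z)) * q z := by
  have h : Measurable (Function.uncurry fun (μ : Measure E3) (z : E3) =>
      F ((κ μ).map (fun x => x - z)) * q z) :=
    (hF.comp (measurable_map_sub_kernel κ)).mul (hq.comp measurable_snd)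
  exact h.comp measurable_prodMk_left

/-- **Splitting** `w + t F = 1` of the weights splits the weighted functionals:
`∫ w(θ_z) q + t ∫ F(θ_z) q = ∫ q`. [folklore] -/
theorem relc_split (κ : Kernel (Measure E3) E3) [IsSFiniteKernel κ] {w F : Measure E3 → ℝ≥0∞}
    (hw : Measurable w) (hF : Measurable F) {t : ℝ≥0∞} (hsplit : ∀ ν, w ν + t * F ν = 1)
    {q : E3 → ℝ≥0∞} (hq : Measurable q) (μ : Measure E3) :
    (∫⁻ z, w ((κ μ).map (fun x => x - z)) * q z ∂(κ μ)) +
      t * ∫⁻ z, F ((κ μ).map (fun x => x - z)) * q z ∂(κ μ) = ∫⁻ z, q z ∂(κ μ) := by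
  rw [← lintegral_const_mul _ (relc_measurable_section κ hF hq μ),
    ← lintegral_add_left (relc_measurable_section κ hw hq μ)]
  refine lintegral_congr fun z => ?_
  rw [← mul_assoc, ← add_mul, hsplit, one_mul]

/-- The splitting in real numbers, on configurations where `∫ q` is finite. [folklore] -/
theorem relc_split_toReal (κ : Kernel (Measure E3) E3) [IsSFiniteKernel κ] {w F : Measure E3 → ℝ≥0∞}
    (hw : Measurable w) (hF : Measurable F) {s : ℝ} (hs : 0 ≤ s)
    (hsplit : ∀ ν, w ν + ENNReal.ofReal s * F ν = 1)
    {q : E3 → ℝ≥0∞} (hq : Measurable q) (μ : Measure E3) (hfin : ∫⁻ z, q z ∂(κ μ) ≠ ∞) :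
    (∫⁻ z, w ((κ μ).map (fun x => x - z)) * q z ∂(κ μ)).toReal =
      (∫⁻ z, q z ∂(κ μ)).toReal - s * (∫⁻ z, F ((κ μ).map (fun x => x - z)) * q z ∂(κ μ)).toReal := by
  have h := relc_split κ hw hF hsplit hq μ
  have h1 : (∫⁻ z, w ((κ μ).map (fun x => x - z)) * q z ∂(κ μ)) ≠ ∞ :=
    ne_top_of_le_ne_top hfin (h ▸ le_self_add)
  have h2 : ENNReal.ofReal s * ∫⁻ z, F ((κ μ).map (fun x => x - z)) * q z ∂(κ μ) ≠ ∞ :=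
    ne_top_of_le_ne_top hfin (h ▸ le_add_self)
  have h3 := congrArg ENNReal.toReal h
  rw [ENNReal.toReal_add h1 h2, ENNReal.toReal_mul, ENNReal.toReal_ofReal hs] at h3
  linarith

/-- A weight `≤ 1` does not increase a weighted functional: `∫ F(θ_z) q ≤ ∫ q`. [folklore] -/
theorem relc_weighted_le (κ : Kernel (Measure E3) E3) {F : Measure E3 → ℝ≥0∞} (hF1 : ∀ ν, F ν ≤ 1)
    (q : E3 → ℝ≥0∞) (μ : Measure E3) :
    ∫⁻ z, F ((κ μ).map (fun x => x - z)) * q z ∂(κ μ) ≤ ∫⁻ z, q z ∂(κ μ) :=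
  lintegral_mono fun _ => (mul_le_mul' (hF1 _) le_rfl).trans_eq (one_mul _)

/-- **Real parts of bounded non-negative functionals** over a probability law: integrable, bounded, and the Bochner
integral of the real part is the real part of the `lintegral`. [folklore] -/
theorem relc_pack [IsProbabilityMeasure P] {G : Measure E3 → ℝ≥0∞} (hG : Measurable G) {c : ℝ} (hc : 0 ≤ c)
    (hb : ∀ᵐ μ ∂P, G μ ≤ ENNReal.ofReal c) :
    Integrable (fun μ => (G μ).toReal) P ∧ (∀ᵐ μ ∂P, 0 ≤ (G μ).toReal ∧ (G μ).toReal ≤ c) ∧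
      ∫ μ, (G μ).toReal ∂P = (∫⁻ μ, G μ ∂P).toReal ∧ ∫⁻ μ, G μ ∂P ≠ ∞ := by
  have hb' : ∀ᵐ μ ∂P, 0 ≤ (G μ).toReal ∧ (G μ).toReal ≤ c := hb.mono fun μ h =>
    ⟨ENNReal.toReal_nonneg, ENNReal.toReal_le_of_le_ofReal hc h⟩
  refine ⟨Integrable.of_bound hG.ennreal_toReal.aestronglyMeasurable c (hb'.mono fun μ h => ?_), hb',
    integral_toReal hG.aemeasurable (hb.mono fun μ h => h.trans_lt ENNReal.ofReal_lt_top), ?_⟩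
  · rw [Real.norm_eq_abs, abs_of_nonneg h.1]; exact h.2
  · refine ((lintegral_mono_ae hb).trans_lt ?_).ne
    rw [lintegral_const, measure_univ, mul_one]; exact ENNReal.ofReal_lt_top

/-- **Mecke symmetrisation.** For a point-stationary law, a measurable weight `F` and an even measurable field
`q ≥ 0`: `E_P[F(μ) ∫ q dμ] = E_P[∫ F(θ_y μ) q(y) dμ(y)]`. [folklore] -/
theorem relc_mecke (hstat : IsPointStationaryLaw P) {F : Measure E3 → ℝ≥0∞} (hF : Measurable F)
    {q : E3 → ℝ≥0∞} (hq : Measurable q) (hqs : ∀ y, q (-y) = q y) :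
    ∫⁻ μ, F μ * ∫⁻ y, q y ∂μ ∂P = ∫⁻ μ, ∫⁻ y, F (μ.map (fun x => x - y)) * q y ∂μ ∂P := by
  have hg : Measurable (Function.uncurry fun (μ : Measure E3) (y : E3) => F μ * q y) :=
    (hF.comp measurable_fst).mul (hq.comp measurable_snd)
  have key := hstat (fun μ y => F μ * q y) hg
  simp only [hqs] at key
  rw [← key]
  refine lintegral_congr fun μ => ?_
  rw [lintegral_const_mul _ hq]

/-- **Mecke symmetrisation, real form** (through an identity-on-hard-core kernel `κ`):
`E_P[(∫ F(θ_z) q)ʳ] = E_P[f · (∫ q)ʳ]` for `F = ofReal ∘ f ≤ 1` and `∫ q` uniformly bounded. [folklore] -/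
theorem relc_mecke_toReal [IsProbabilityMeasure P] (κ : Kernel (Measure E3) E3) [IsSFiniteKernel κ]
    (hκ : ∀ μ : Measure E3, IsRootedHardCore δ μ → κ μ = μ) (hcore : ∀ᵐ μ ∂P, IsRootedHardCore δ μ)
    (hstat : IsPointStationaryLaw P) {F : Measure E3 → ℝ≥0∞} (hF : Measurable F) (hF1 : ∀ ν, F ν ≤ 1)
    {f : Measure E3 → ℝ} (hFf : ∀ ν, (F ν).toReal = f ν) {q : E3 → ℝ≥0∞} (hq : Measurable q)
    (hqs : ∀ y, q (-y) = q y) {c : ℝ} (hc : 0 ≤ c) (hb : ∀ᵐ μ ∂P, ∫⁻ z, q z ∂(κ μ) ≤ ENNReal.ofReal c) :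
    ∫ μ, (∫⁻ z, F ((κ μ).map (fun x => x - z)) * q z ∂(κ μ)).toReal ∂P =
      ∫ μ, f μ * (∫⁻ z, q z ∂(κ μ)).toReal ∂P := by
  have hmecke : ∫⁻ μ, F μ * ∫⁻ z, q z ∂(κ μ) ∂P = ∫⁻ μ, ∫⁻ z, F ((κ μ).map (fun x => x - z)) * q z ∂(κ μ) ∂P := by
    have h1 : ∫⁻ μ, F μ * ∫⁻ z, q z ∂(κ μ) ∂P = ∫⁻ μ, F μ * ∫⁻ z, q z ∂μ ∂P := by
      refine lintegral_congr_ae ?_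
      filter_upwards [hcore] with μ hμ
      rw [hκ μ hμ]
    have h2 : ∫⁻ μ, ∫⁻ z, F ((κ μ).map (fun x => x - z)) * q z ∂(κ μ) ∂P =
        ∫⁻ μ, ∫⁻ z, F (μ.map (fun x => x - z)) * q z ∂μ ∂P := by
      refine lintegral_congr_ae ?_
      filter_upwards [hcore] with μ hμ
      rw [hκ μ hμ]
    rw [h1, h2]
    exact relc_mecke hstat hF hq hqs
  have hGm : Measurable fun μ => F μ * ∫⁻ z, q z ∂(κ μ) := hF.mul hq.lintegral_kernel
  have hGb : ∀ᵐ μ ∂P, F μ * ∫⁻ z, q z ∂(κ μ) ≤ ENNReal.ofReal c := hb.mono fun μ h =>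
    (mul_le_mul' (hF1 μ) h).trans_eq (one_mul _)
  have hWb : ∀ᵐ μ ∂P, ∫⁻ z, F ((κ μ).map (fun x => x - z)) * q z ∂(κ μ) ≤ ENNReal.ofReal c :=
    hb.mono fun μ h => (relc_weighted_le κ hF1 q μ).trans h
  obtain ⟨-, -, hGe, -⟩ := relc_pack hGm hc hGb
  obtain ⟨-, -, hWe, -⟩ := relc_pack (relc_measurable_weighted κ hF hq) hc hWb
  rw [hWe, ← hmecke, ← hGe]
  refine integral_congr_ae (ae_of_all _ fun μ => ?_)
  simp only [ENNReal.toReal_mul, hFf]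

end Aux

/-! ## The variation inequality in real numbers -/

section Variation

variable {δ : ℝ} {P : Measure (Measure E3)}

/-- **Copositivity at `w = 1 - s f`, in real numbers.** With `ap, am, fp, fm` the real parts of the (kernel
versions of the) functionals `∫ V⁺`, `∫ V⁻`, `∫ F(θ_z)V⁺`, `∫ F(θ_z)V⁻` (`F = ofReal ∘ f`, `0 ≤ f ≤ 1`,
`0 < s ≤ 1`): `∫ (1 - s f)(am - s fm) ≤ ∫ (1 - s f)(ap - s fp) + 2(-e*) ∫ (1 - s f)²`. [folklore] -/
theorem relc_variation [IsProbabilityMeasure P] (hδ : 0 < δ) (κ : Kernel (Measure E3) E3) [IsSFiniteKernel κ]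
    (hκ : ∀ μ : Measure E3, IsRootedHardCore δ μ → κ μ = μ) (hcore : ∀ᵐ μ ∂P, IsRootedHardCore δ μ)
    (hcop : ∀ w : Measure E3 → ℝ≥0∞, Measurable w → (∀ μ, w μ ≤ 1) →
      ∫⁻ μ, w μ * (∫⁻ z, w (Measure.map (fun x => x - z) μ) * ENNReal.ofReal (-lennardJones ‖z‖) ∂μ) ∂P ≤
        ∫⁻ μ, w μ * (∫⁻ z, w (Measure.map (fun x => x - z) μ) * ENNReal.ofReal (lennardJones ‖z‖) ∂μ) ∂P +
          2 * ENNReal.ofReal (-eStar) * ∫⁻ μ, (w μ) ^ 2 ∂P)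
    {f : Measure E3 → ℝ} (hf : Measurable f) (hf01 : ∀ ν, 0 ≤ f ν ∧ f ν ≤ 1)
    (ap am fp fm : Measure E3 → ℝ)
    (hap : ∀ μ, ap μ = (∫⁻ z, ENNReal.ofReal (lennardJones ‖z‖) ∂(κ μ)).toReal)
    (ham : ∀ μ, am μ = (∫⁻ z, ENNReal.ofReal (-lennardJones ‖z‖) ∂(κ μ)).toReal)
    (hfp : ∀ μ, fp μ = (∫⁻ z, ENNReal.ofReal (f ((κ μ).map (fun x => x - z))) *
      ENNReal.ofReal (lennardJones ‖z‖) ∂(κ μ)).toReal)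
    (hfm : ∀ μ, fm μ = (∫⁻ z, ENNReal.ofReal (f ((κ μ).map (fun x => x - z))) *
      ENNReal.ofReal (-lennardJones ‖z‖) ∂(κ μ)).toReal)
    {s : ℝ} (hs : 0 < s) (hs1 : s ≤ 1) :
    ∫ μ, (1 - s * f μ) * (am μ - s * fm μ) ∂P ≤
      ∫ μ, (1 - s * f μ) * (ap μ - s * fp μ) ∂P + 2 * (-eStar) * ∫ μ, (1 - s * f μ) ^ 2 ∂P := by
  -- fields and weights
  obtain ⟨p, hp_def⟩ : ∃ p : E3 → ℝ≥0∞, p = fun z => ENNReal.ofReal (lennardJones ‖z‖) := ⟨_, rfl⟩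
  obtain ⟨m, hm_def⟩ : ∃ m : E3 → ℝ≥0∞, m = fun z => ENNReal.ofReal (-lennardJones ‖z‖) := ⟨_, rfl⟩
  have hp : Measurable p := hp_def ▸ measurable_ofReal_lennardJones_norm
  have hm : Measurable m := hm_def ▸ measurable_ofReal_neg_lennardJones_norm
  obtain ⟨F, hF_def⟩ : ∃ F : Measure E3 → ℝ≥0∞, F = fun ν => ENNReal.ofReal (f ν) := ⟨_, rfl⟩
  have hF : Measurable F := hF_def ▸ ENNReal.measurable_ofReal.comp hf
  obtain ⟨wr, hwr_def⟩ : ∃ wr : Measure E3 → ℝ, wr = fun ν => 1 - s * f ν := ⟨_, rfl⟩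
  have hwr01 : ∀ ν, 0 ≤ wr ν ∧ wr ν ≤ 1 := fun ν => by
    have := hf01 ν
    rw [hwr_def]
    constructor <;> nlinarith
  have hwrm : Measurable wr := hwr_def ▸ measurable_const.sub (hf.const_mul s)
  obtain ⟨w, hw_def⟩ : ∃ w : Measure E3 → ℝ≥0∞, w = fun ν => ENNReal.ofReal (wr ν) := ⟨_, rfl⟩
  have hw : Measurable w := hw_def ▸ ENNReal.measurable_ofReal.comp hwrm
  have hw1 : ∀ ν, w ν ≤ 1 := fun ν => by rw [hw_def]; exact ENNReal.ofReal_le_one.2 (hwr01 ν).2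
  have hwreal : ∀ ν, (w ν).toReal = 1 - s * f ν := fun ν => by
    rw [hw_def, ENNReal.toReal_ofReal (hwr01 ν).1, hwr_def]
  have hsplit : ∀ ν, w ν + ENNReal.ofReal s * F ν = 1 := fun ν => by
    rw [hw_def, hF_def, hwr_def]
    dsimp only
    rw [← ENNReal.ofReal_mul hs.le, ← ENNReal.ofReal_add (by nlinarith [(hf01 ν).1, (hf01 ν).2, hs.le, hs1])
      (by nlinarith [(hf01 ν).1, hs.le]), ← ENNReal.ofReal_one]
    congr 1; ring
  -- kernel versions of the weighted functionals
  obtain ⟨Wp, hWp_def⟩ : ∃ Wp : Measure E3 → ℝ≥0∞,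
      Wp = fun μ => ∫⁻ z, w ((κ μ).map (fun x => x - z)) * p z ∂(κ μ) := ⟨_, rfl⟩
  obtain ⟨Wm, hWm_def⟩ : ∃ Wm : Measure E3 → ℝ≥0∞,
      Wm = fun μ => ∫⁻ z, w ((κ μ).map (fun x => x - z)) * m z ∂(κ μ) := ⟨_, rfl⟩
  have hWpm : Measurable Wp := hWp_def ▸ relc_measurable_weighted κ hw hp
  have hWmm : Measurable Wm := hWm_def ▸ relc_measurable_weighted κ hw hm
  have hWp_le : ∀ μ, Wp μ ≤ ∫⁻ z, p z ∂(κ μ) := fun μ => by rw [hWp_def]; exact relc_weighted_le κ hw1 p μ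
  have hWm_le : ∀ μ, Wm μ ≤ ∫⁻ z, m z ∂(κ μ) := fun μ => by rw [hWm_def]; exact relc_weighted_le κ hw1 m μ
  -- copositivity at `w`, kernel versions inside
  have hcw : ∫⁻ μ, w μ * Wm μ ∂P ≤ ∫⁻ μ, w μ * Wp μ ∂P + 2 * ENNReal.ofReal (-eStar) * ∫⁻ μ, (w μ) ^ 2 ∂P := by
    have h := hcop w hw hw1
    have hL : ∫⁻ μ, w μ * (∫⁻ z, w (Measure.map (fun x => x - z) μ) * ENNReal.ofReal (-lennardJones ‖z‖) ∂μ) ∂P =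
        ∫⁻ μ, w μ * Wm μ ∂P := by
      refine lintegral_congr_ae ?_
      filter_upwards [hcore] with μ hμ
      rw [hWm_def, hm_def]
      dsimp only
      rw [hκ μ hμ]
    have hR : ∫⁻ μ, w μ * (∫⁻ z, w (Measure.map (fun x => x - z) μ) * ENNReal.ofReal (lennardJones ‖z‖) ∂μ) ∂P =
        ∫⁻ μ, w μ * Wp μ ∂P := by
      refine lintegral_congr_ae ?_
      filter_upwards [hcore] with μ hμ
      rw [hWp_def, hp_def]
      dsimp only
      rw [hκ μ hμ]
    rwa [hL, hR] at h
  -- uniform bounds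
  set cp : ℝ := 250 / 12 * δ⁻¹ ^ 12 with hcp
  set cm : ℝ := 250 / 6 * δ⁻¹ ^ 6 with hcm
  have hcp0 : 0 ≤ cp := by positivity
  have hcm0 : 0 ≤ cm := by positivity
  have hbAp : ∀ᵐ μ ∂P, ∫⁻ z, p z ∂(κ μ) ≤ ENNReal.ofReal cp := by
    filter_upwards [hcore] with μ hμ
    rw [hκ μ hμ, hp_def]; exact lintegral_pos_le_of_hc hδ hμ
  have hbAm : ∀ᵐ μ ∂P, ∫⁻ z, m z ∂(κ μ) ≤ ENNReal.ofReal cm := by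
    filter_upwards [hcore] with μ hμ
    rw [hκ μ hμ, hm_def]; exact lintegral_neg_le_of_hc hδ hμ
  have hbL : ∀ᵐ μ ∂P, w μ * Wm μ ≤ ENNReal.ofReal cm := hbAm.mono fun μ h =>
    (mul_le_mul' (hw1 μ) ((hWm_le μ).trans h)).trans_eq (one_mul _)
  have hbR : ∀ᵐ μ ∂P, w μ * Wp μ ≤ ENNReal.ofReal cp := hbAp.mono fun μ h =>
    (mul_le_mul' (hw1 μ) ((hWp_le μ).trans h)).trans_eq (one_mul _)
  have hbQ : ∀ᵐ μ ∂P, (w μ) ^ 2 ≤ ENNReal.ofReal 1 := ae_of_all _ fun μ => by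
    rw [ENNReal.ofReal_one]; exact pow_le_one' (hw1 μ) 2
  obtain ⟨-, -, hLe, -⟩ := relc_pack (G := fun μ => w μ * Wm μ) (hw.mul hWmm) hcm0 hbL
  obtain ⟨-, -, hRe, hRfin⟩ := relc_pack (G := fun μ => w μ * Wp μ) (hw.mul hWpm) hcp0 hbR
  obtain ⟨-, -, hQe, hQfin⟩ := relc_pack (G := fun μ => (w μ) ^ 2) (hw.pow_const 2) zero_le_one hbQ
  -- pass to real numbers
  have he0 : 0 ≤ -eStar := neg_nonneg.2 eStar_nonpos
  have hc_fin : 2 * ENNReal.ofReal (-eStar) ≠ ∞ := ENNReal.mul_ne_top (by simp) ENNReal.ofReal_ne_top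
  have hreal : (∫⁻ μ, w μ * Wm μ ∂P).toReal ≤
      (∫⁻ μ, w μ * Wp μ ∂P).toReal + 2 * (-eStar) * (∫⁻ μ, (w μ) ^ 2 ∂P).toReal := by
    have h := ENNReal.toReal_mono (ENNReal.add_ne_top.2 ⟨hRfin, ENNReal.mul_ne_top hc_fin hQfin⟩) hcw
    rwa [ENNReal.toReal_add hRfin (ENNReal.mul_ne_top hc_fin hQfin), ENNReal.toReal_mul,
      ENNReal.toReal_mul, ENNReal.toReal_ofReal he0, ENNReal.toReal_ofNat] at h
  rw [← hLe, ← hRe, ← hQe] at hreal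
  -- identify the three real integrands almost surely
  have hfF : ∀ μ z, ENNReal.ofReal (f ((κ μ).map (fun x => x - z))) = F ((κ μ).map (fun x => x - z)) :=
    fun μ z => by rw [hF_def]
  have hLi : ∫ μ, (w μ * Wm μ).toReal ∂P = ∫ μ, (1 - s * f μ) * (am μ - s * fm μ) ∂P := by
    refine integral_congr_ae ?_
    filter_upwards [hbAm] with μ h
    have hfin : ∫⁻ z, m z ∂(κ μ) ≠ ∞ := ne_top_of_le_ne_top ENNReal.ofReal_ne_top h
    rw [ENNReal.toReal_mul, hwreal, hWm_def, ham, hfm]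
    dsimp only
    rw [relc_split_toReal κ hw hF hs.le hsplit hm μ hfin, hm_def]
    simp only [hfF]
  have hRi : ∫ μ, (w μ * Wp μ).toReal ∂P = ∫ μ, (1 - s * f μ) * (ap μ - s * fp μ) ∂P := by
    refine integral_congr_ae ?_
    filter_upwards [hbAp] with μ h
    have hfin : ∫⁻ z, p z ∂(κ μ) ≠ ∞ := ne_top_of_le_ne_top ENNReal.ofReal_ne_top h
    rw [ENNReal.toReal_mul, hwreal, hWp_def, hap, hfp]
    dsimp only
    rw [relc_split_toReal κ hw hF hs.le hsplit hp μ hfin, hp_def]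
    simp only [hfF]
  have hQi : ∫ μ, ((w μ) ^ 2).toReal ∂P = ∫ μ, (1 - s * f μ) ^ 2 ∂P := by
    refine integral_congr_ae (ae_of_all _ fun μ => ?_)
    simp only [ENNReal.toReal_pow, hwreal]
  rw [hLi, hRi, hQi] at hreal
  exact hreal

/-- **The first-order condition, abstract form.** On a probability space let `f, ap, am, fp, fm` be integrable real
functions (with the listed products integrable), `∫ fp = ∫ f ap`, `∫ fm = ∫ f am` (Mecke), `∫ (ap - am) ≤ 2e`
(minimality), `∫ f fp - ∫ f fm - 2e ∫ f² ≤ C` (`C > 0`), and the variation inequality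
`∫ (1 - s f)(am - s fm) ≤ ∫ (1 - s f)(ap - s fp) + 2(-e)∫(1 - s f)²` for all `0 < s ≤ 1/2`.  Then
`∫ f ((ap - am)/2 - e) ≤ 0`. [folklore] -/
theorem relc_first_order {α : Type*} [MeasurableSpace α] {μ : Measure α} [IsProbabilityMeasure μ]
    {f ap am fp fm : α → ℝ} {e C : ℝ}
    (hf_i : Integrable f μ) (hap_i : Integrable ap μ) (ham_i : Integrable am μ)
    (hfp_i : Integrable fp μ) (hfm_i : Integrable fm μ)
    (hfap_i : Integrable (fun x => f x * ap x) μ) (hfam_i : Integrable (fun x => f x * am x) μ)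
    (hffp_i : Integrable (fun x => f x * fp x) μ) (hffm_i : Integrable (fun x => f x * fm x) μ)
    (hff_i : Integrable (fun x => f x * f x) μ)
    (hMp : ∫ x, fp x ∂μ = ∫ x, f x * ap x ∂μ) (hMm : ∫ x, fm x ∂μ = ∫ x, f x * am x ∂μ)
    (hmin : ∫ x, (ap x - am x) ∂μ ≤ 2 * e)
    (hG2 : ∫ x, f x * fp x ∂μ - ∫ x, f x * fm x ∂μ - 2 * e * ∫ x, f x * f x ∂μ ≤ C) (hC : 0 < C)
    (hvar : ∀ s : ℝ, 0 < s → s ≤ 1 / 2 →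
      ∫ x, (1 - s * f x) * (am x - s * fm x) ∂μ ≤
        ∫ x, (1 - s * f x) * (ap x - s * fp x) ∂μ + 2 * (-e) * ∫ x, (1 - s * f x) ^ 2 ∂μ) :
    ∫ x, f x * ((ap x - am x) / 2 - e) ∂μ ≤ 0 := by
  set J : ℝ := ∫ x, f x * ((ap x - am x) / 2 - e) ∂μ with hJ_def
  have hJ : J = (∫ x, f x * ap x ∂μ - ∫ x, f x * am x ∂μ) / 2 - e * ∫ x, f x ∂μ := by
    have h1 : J = ∫ x, ((f x * ap x - f x * am x) / 2 - e * f x) ∂μ :=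
      integral_congr_ae (ae_of_all _ fun x => by ring)
    have i1 : Integrable (fun x => (f x * ap x - f x * am x) / 2) μ := (hfap_i.sub hfam_i).div_const 2
    have i2 : Integrable (fun x => e * f x) μ := hf_i.const_mul e
    have i3 : Integrable (fun x => f x * ap x - f x * am x) μ := hfap_i.sub hfam_i
    rw [h1, integral_sub i1 i2, integral_div, integral_sub hfap_i hfam_i, integral_const_mul]
  have hkey : ∀ s : ℝ, 0 < s → s ≤ 1 / 2 → J ≤ s * C / 4 := by
    intro s hs hs2
    have hv := hvar s hs hs2
    have eL : ∫ x, (1 - s * f x) * (am x - s * fm x) ∂μ =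
        ∫ x, am x ∂μ - s * ∫ x, fm x ∂μ - s * ∫ x, f x * am x ∂μ + s ^ 2 * ∫ x, f x * fm x ∂μ := by
      have : ∀ x, (1 - s * f x) * (am x - s * fm x) =
          am x - s * fm x - s * (f x * am x) + s ^ 2 * (f x * fm x) := fun x => by ring
      simp_rw [this]
      have i1 : Integrable (fun x => s * fm x) μ := hfm_i.const_mul s
      have i2 : Integrable (fun x => s * (f x * am x)) μ := hfam_i.const_mul s
      have i3 : Integrable (fun x => s ^ 2 * (f x * fm x)) μ := hffm_i.const_mul _
      have i4 : Integrable (fun x => am x - s * fm x) μ := ham_i.sub i1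
      have i5 : Integrable (fun x => am x - s * fm x - s * (f x * am x)) μ := i4.sub i2
      rw [integral_add i5 i3, integral_sub i4 i2, integral_sub ham_i i1, integral_const_mul, integral_const_mul,
        integral_const_mul]
    have eR : ∫ x, (1 - s * f x) * (ap x - s * fp x) ∂μ =
        ∫ x, ap x ∂μ - s * ∫ x, fp x ∂μ - s * ∫ x, f x * ap x ∂μ + s ^ 2 * ∫ x, f x * fp x ∂μ := by
      have : ∀ x, (1 - s * f x) * (ap x - s * fp x) =
          ap x - s * fp x - s * (f x * ap x) + s ^ 2 * (f x * fp x) := fun x => by ring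
      simp_rw [this]
      have i1 : Integrable (fun x => s * fp x) μ := hfp_i.const_mul s
      have i2 : Integrable (fun x => s * (f x * ap x)) μ := hfap_i.const_mul s
      have i3 : Integrable (fun x => s ^ 2 * (f x * fp x)) μ := hffp_i.const_mul _
      have i4 : Integrable (fun x => ap x - s * fp x) μ := hap_i.sub i1
      have i5 : Integrable (fun x => ap x - s * fp x - s * (f x * ap x)) μ := i4.sub i2
      rw [integral_add i5 i3, integral_sub i4 i2, integral_sub hap_i i1, integral_const_mul, integral_const_mul,
        integral_const_mul]
    have eQ : ∫ x, (1 - s * f x) ^ 2 ∂μ = 1 - 2 * s * ∫ x, f x ∂μ + s ^ 2 * ∫ x, f x * f x ∂μ := by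
      have : ∀ x, (1 - s * f x) ^ 2 = (1 : ℝ) - 2 * s * f x + s ^ 2 * (f x * f x) := fun x => by ring
      simp_rw [this]
      have i1 : Integrable (fun x => 2 * s * f x) μ := hf_i.const_mul _
      have i2 : Integrable (fun x => s ^ 2 * (f x * f x)) μ := hff_i.const_mul _
      have i4 : Integrable (fun x => (1 : ℝ) - 2 * s * f x) μ := (integrable_const 1).sub i1
      rw [integral_add i4 i2, integral_sub (integrable_const 1) i1, integral_const_mul, integral_const_mul,
        integral_const]
      simp
    have eApm : ∫ x, ap x ∂μ - ∫ x, am x ∂μ ≤ 2 * e := by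
      rw [← integral_sub hap_i ham_i]; exact hmin
    rw [eL, eR, eQ, hMp, hMm] at hv
    have h4 : 4 * s * J ≤ s ^ 2 * C := by
      rw [hJ]
      nlinarith [hv, eApm, mul_le_mul_of_nonneg_left hG2 (sq_nonneg s)]
    have h5 : s * (4 * J) ≤ s * (s * C) := by nlinarith [h4]
    have h6 := le_of_mul_le_mul_left h5 hs
    linarith
  by_contra hJle
  have hJpos : 0 < J := not_le.1 hJle
  set s : ℝ := min (1 / 2) (2 * J / C) with hs_def
  have hs : 0 < s := lt_min (by norm_num) (by positivity)
  have h1 := hkey s hs (min_le_left _ _)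
  have h2 : s * C ≤ 2 * J := by
    have hsJ : s ≤ 2 * J / C := min_le_right _ _
    rwa [le_div_iff₀ hC] at hsJ
  linarith

end Variation

end Summit.AtomisticToContinuum.Crystallization.Theorems.IsometryAtomsMinimisingLawsHaveAtoms

end
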